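import Summits.SmoothPoincare4.SmoothPoincare4.Theorems.CongruenceShadowsNormalFormStablyTrivialLuftDefs

/-!
# Stub `stub_eraseStabilize` of line `luft-twist-reduction` for crux `NormalFormStablyTrivial`
# (item stmt-SmoothPoincare4-14591, route `CongruenceShadows`) — the erasure of a stabilised triple

Proves the registered stub **`stub_eraseStabilize : EraseStabilize`** verbatim (`EraseStabilize`,
`…LuftDefs.lean` §4): for a kernel triple `K` at level `m` (genus `3 + 3m`) with `K₂` normal, the
free shadow (image under the erasure `eraseN1 (m+n) : S_{3+3(m+n)} → F_{3+3(m+n)} = π₁(H₁)` of the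
middle handlebody) of the `n`-fold stabilisation of `K` is the normal closure of the level-included
free shadow of `K` together with the standard new generators `xᵢ`, `3 + 3m ≤ i`, `i ≢ 2 (mod 3)`:

  `erase ((K # n·K_{S⁴})₂) = ⟪ι (erase K₂) ∪ {xᵢ : 3+3m ≤ i, i ≢ 2 (3)}⟫`.

Pure bookkeeping over the tree's definitions (`TrisectionKernels.stabilize_apply`, `stabSet`,
`genIncl`/`genShift`, `presentedLift` of `GroupTrisections.lean`; the erasure values of
`SurfaceGroupCutKernels.lean`):

* §1 `normalClosure_image_normalClosure_union` — `⟪f ⟪s⟫ ∪ t⟫ = ⟪f s ∪ t⟫`.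
* §2 ONE STABILISATION THROUGH AN ERASURE, generic genus `g ↦ g + 3` and an abstract pair of
  erasures `ε₀ : S_g → F_g`, `ε : S_{g+3} → F_{g+3}` compatible on the re-embedded letters
  (`ε ∘ ι = F(ι) ∘ ε₀`) and with the slot-`1` values on the three new handles (`a_g ↦ 1`,
  `b_g ↦ x_g`, `a_{g+1} ↦ x_{g+1}⁻¹`, `b_{g+1} ↦ 1`, `a_{g+2} ↦ 1`): then
  `ε (K.stabilize)₂ = ⟪F(ι) (ε₀ K₂) ∪ {x_g, x_{g+1}}⟫` (`map_stabilize_two`).  The shifted part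
  factors through `S_3 → F_{g+3}` (the genus-`3` relator dies since `a_g, b_{g+1}, a_{g+2}` do) and
  `(K_{S⁴})₂ = ⟪b₀, a₁, a₂⟫ ↦ ⟪x_g, x_{g+1}⁻¹, 1⟫`.
* §3 the level vocabulary: the slot-`1` cut pattern on re-embedded / new handles, the values of
  `eraseN1 (ℓ+1)` there, `levelIncl`/`newStdGens` one level up, and the one-step identity through
  the transport `cast` (by `subst`, as in `…LuftStubGateAscent.lean`).
* §4 the stub, by induction on `n` (`n = 0`: the image of the normal subgroup `K₂` under the
  surjective erasure is normal — the only use of normality).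

References: Abrams–Gay–Kirby, Geom. Topol. 22 (2018), Def. 2–3; Zieschang–Vogt–Coldewey, LNM 835
(1980), §3.2.
-/

-- the prescribed namespace `Summit.<P>.<Sub>.…` duplicates `SmoothPoincare4` (P = Sub)
set_option linter.dupNamespace false

noncomputable section

namespace Summit.SmoothPoincare4.SmoothPoincare4.Theorems.NormalFormStablyTrivial.Luft

open Literature.Topology.FourManifolds Subgroup

/-! ## §1 Normal closures under homomorphisms -/

/-- `⟪f ⟪s⟫ ∪ t⟫ = ⟪f s ∪ t⟫`: inside a normal closure the image of a normal closure may be replaced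
by the image of its generators (`f` need not be surjective). [folklore] -/
theorem normalClosure_image_normalClosure_union {G H : Type*} [Group G] [Group H] (f : G →* H)
    (s : Set G) (t : Set H) :
    normalClosure (f '' (normalClosure s : Set G) ∪ t) = normalClosure (f '' s ∪ t) := by
  apply le_antisymm
  · refine normalClosure_le_normal
      (Set.union_subset ?_ fun y hy => subset_normalClosure (Or.inr hy))
    rintro _ ⟨x, hx, rfl⟩
    have h : normalClosure s ≤ (normalClosure (f '' s ∪ t)).comap f :=
      normalClosure_le_normal fun y hy => subset_normalClosure (Or.inl ⟨y, hy, rfl⟩)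
    exact h hx
  · exact normalClosure_mono (Set.union_subset_union_left _ (Set.image_mono subset_normalClosure))

/-! ## §2 One stabilisation through an erasure (generic genus) -/

variable {g : ℕ}

/-- A pair of erasures compatible on the re-embedded letters is compatible on all re-embedded
words: `ε (ι x) = F(ι) (ε₀ x)`. [folklore] -/
theorem erase_mk_genIncl (ε₀ : SurfaceGroup g →* FreeGroup (Fin g))
    (ε : SurfaceGroup (g + 3) →* FreeGroup (Fin (g + 3)))
    (hI : ∀ (i : Fin g) (β : Bool), ε (PresentedGroup.of (Fin.castAdd 3 i, β)) =
      FreeGroup.map (Fin.castAdd 3) (ε₀ (PresentedGroup.of (i, β))))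
    (x : FreeGroup (surfaceGen g)) :
    ε (PresentedGroup.mk _ (genIncl g x)) =
      FreeGroup.map (Fin.castAdd 3) (ε₀ (PresentedGroup.mk _ x)) := by
  have h : ε.comp ((PresentedGroup.mk _).comp (genIncl g)) =
      (FreeGroup.map (Fin.castAdd 3)).comp (ε₀.comp (PresentedGroup.mk _)) :=
    FreeGroup.ext_hom _ _ fun p => by
      simp only [MonoidHom.comp_apply, genIncl_of]
      exact hI p.1 p.2
  exact DFunLike.congr_fun h x

/-- **Shifted words of `(K_{S⁴})₂` die modulo the new standard generators.**  If `ε` kills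
`a_g, b_{g+1}, a_{g+2}` (so `ε ∘ σ` kills the genus-`3` relator and factors through `S_3`) and sends
`b_g`, `a_{g+1}` into the normal subgroup `N`, then `ε (σ x) ∈ N` for every word `x` whose class
lies in `(K_{S⁴})₂ = ⟪b₀, a₁, a₂⟫`. [folklore] -/
theorem erase_mk_genShift_mem {T : Type*} [Group T] (ε : SurfaceGroup (g + 3) →* T)
    (N : Subgroup T) [N.Normal]
    (ha0 : ε (PresentedGroup.of (Fin.natAdd g 0, false)) = 1)
    (hb0 : ε (PresentedGroup.of (Fin.natAdd g 0, true)) ∈ N)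
    (ha1 : ε (PresentedGroup.of (Fin.natAdd g 1, false)) ∈ N)
    (hb1 : ε (PresentedGroup.of (Fin.natAdd g 1, true)) = 1)
    (ha2 : ε (PresentedGroup.of (Fin.natAdd g 2, false)) = 1)
    (x : FreeGroup (surfaceGen 3)) (hx : PresentedGroup.mk _ x ∈ s4Kernels 2) :
    ε (PresentedGroup.mk _ (genShift g x)) ∈ N := by
  -- the values of `ε ∘ σ` on the genus-`3` letters
  have hof : ∀ (k : Fin 3) (β : Bool), (ε.comp ((PresentedGroup.mk _).comp (genShift g)))
      (FreeGroup.of (k, β)) = ε (PresentedGroup.of (Fin.natAdd g k, β)) := fun k β => by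
    simp only [MonoidHom.comp_apply, genShift_of]
    rfl
  -- `ε ∘ σ` kills the genus-`3` relator (one letter of every new handle dies)
  have hrel : ∀ r ∈ ({surfaceRelator 3} : Set (FreeGroup (surfaceGen 3))),
      (ε.comp ((PresentedGroup.mk _).comp (genShift g))) r = 1 := by
    intro r hr
    rw [Set.mem_singleton_iff] at hr
    rw [hr, ← freeGroup_lift_comp_of (ε.comp _)]
    refine SurfaceGroup.lift_surfaceRelator_eq_one_of_hits _ fun j => ?_
    simp only [Function.comp_apply, hof]
    fin_cases j
    · exact Or.inl ha0
    · exact Or.inr hb1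
    · exact Or.inl ha2
  -- so it descends to `φ : S_3 → T`, and `⟪b₀, a₁, a₂⟫ ≤ φ⁻¹ N`
  have hφ : ∀ (k : Fin 3) (β : Bool), presentedLift _ hrel (PresentedGroup.of (k, β)) =
      ε (PresentedGroup.of (Fin.natAdd g k, β)) := fun k β => by
    rw [presentedLift_of, hof]
  have hker : s4Kernels 2 ≤ N.comap (presentedLift _ hrel) := by
    show normalClosure {SurfaceGroup.b 0, SurfaceGroup.a 1, SurfaceGroup.a 2} ≤ _
    refine normalClosure_le_normal ?_
    rintro _ (rfl | rfl | rfl)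
    · show presentedLift _ hrel (PresentedGroup.of (0, true)) ∈ N
      rw [hφ]
      exact hb0
    · show presentedLift _ hrel (PresentedGroup.of (1, false)) ∈ N
      rw [hφ]
      exact ha1
    · show presentedLift _ hrel (PresentedGroup.of (2, false)) ∈ N
      rw [hφ, ha2]
      exact one_mem _
  have h := hker hx
  rw [mem_comap, presentedLift_mk] at h
  exact h

/-- **One stabilisation through an erasure.**  Let `ε₀ : S_g → F_g` and a SURJECTIVE
`ε : S_{g+3} → F_{g+3}` be compatible on the re-embedded letters (`ε (ι p) = F(ι) (ε₀ p)`) and let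
`ε` take the slot-`1` values on the three new handles (`a_g ↦ 1`, `b_g ↦ x_g`,
`a_{g+1} ↦ x_{g+1}⁻¹`, `b_{g+1} ↦ 1`, `a_{g+2} ↦ 1`).  Then the `ε`-image of the stabilised third
kernel is `⟪F(ι) (ε₀ K₂) ∪ {x_g, x_{g+1}}⟫`. [folklore] -/
theorem map_stabilize_two (K : TrisectionKernels g) (ε₀ : SurfaceGroup g →* FreeGroup (Fin g))
    (ε : SurfaceGroup (g + 3) →* FreeGroup (Fin (g + 3))) (hε : Function.Surjective ε)
    (hI : ∀ (i : Fin g) (β : Bool), ε (PresentedGroup.of (Fin.castAdd 3 i, β)) =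
      FreeGroup.map (Fin.castAdd 3) (ε₀ (PresentedGroup.of (i, β))))
    (ha0 : ε (PresentedGroup.of (Fin.natAdd g 0, false)) = 1)
    (hb0 : ε (PresentedGroup.of (Fin.natAdd g 0, true)) = FreeGroup.of (Fin.natAdd g 0))
    (ha1 : ε (PresentedGroup.of (Fin.natAdd g 1, false)) = (FreeGroup.of (Fin.natAdd g 1))⁻¹)
    (hb1 : ε (PresentedGroup.of (Fin.natAdd g 1, true)) = 1)
    (ha2 : ε (PresentedGroup.of (Fin.natAdd g 2, false)) = 1) :
    (K.stabilize 2).map ε =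
      normalClosure (FreeGroup.map (Fin.castAdd 3) '' ((K 2).map ε₀ : Set (FreeGroup (Fin g))) ∪
        {FreeGroup.of (Fin.natAdd g 0), FreeGroup.of (Fin.natAdd g 1)}) := by
  rw [TrisectionKernels.stabilize_apply]
  apply le_antisymm
  · rw [map_le_iff_le_comap]
    refine normalClosure_le_normal ?_
    rintro _ (⟨x, hx, rfl⟩ | ⟨x, hx, rfl⟩)
    · -- a re-embedded word of `K₂`
      show ε (PresentedGroup.mk _ (genIncl g x)) ∈ normalClosure _
      rw [erase_mk_genIncl ε₀ ε hI]
      exact subset_normalClosure (Or.inl ⟨ε₀ (PresentedGroup.mk _ x),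
        mem_map_of_mem ε₀ (show PresentedGroup.mk _ x ∈ K 2 from hx), rfl⟩)
    · -- a shifted word of `(K_{S⁴})₂`
      show ε (PresentedGroup.mk _ (genShift g x)) ∈ normalClosure _
      refine erase_mk_genShift_mem ε _ ha0 ?_ ?_ hb1 ha2 x hx
      · rw [hb0]
        exact subset_normalClosure (Or.inr (Set.mem_insert _ _))
      · rw [ha1]
        exact inv_mem (subset_normalClosure (Or.inr (Set.mem_insert_of_mem _ rfl)))
  · haveI : ((normalClosure (stabSet (K 2 : Set (SurfaceGroup g))
        (s4Kernels 2 : Set (SurfaceGroup 3)))).map ε).Normal :=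
      Subgroup.Normal.map inferInstance ε hε
    refine normalClosure_le_normal ?_
    rintro _ (⟨y, hy, rfl⟩ | hw)
    · obtain ⟨s, hs, rfl⟩ := mem_map.1 hy
      obtain ⟨x, rfl⟩ := PresentedGroup.mk_surjective _ s
      rw [← erase_mk_genIncl ε₀ ε hI]
      exact mem_map_of_mem ε (subset_normalClosure (Or.inl ⟨x, hs, rfl⟩))
    · have hb : (PresentedGroup.of (0, true) : SurfaceGroup 3) ∈ s4Kernels 2 :=
        of_mem_s4Kernels 2 (by decide)
      have ha : (PresentedGroup.of (1, false) : SurfaceGroup 3) ∈ s4Kernels 2 :=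
        of_mem_s4Kernels 2 (by decide)
      rcases hw with rfl | rfl
      · rw [SetLike.mem_coe, ← hb0]
        exact mem_map_of_mem ε (subset_normalClosure (Or.inr ⟨FreeGroup.of (0, true), hb, rfl⟩))
      · rw [SetLike.mem_coe, ← inv_mem_iff, ← ha1]
        exact mem_map_of_mem ε (subset_normalClosure (Or.inr ⟨FreeGroup.of (1, false), ha, rfl⟩))

/-! ## §3 The level vocabulary one step up -/

/-- The slot-`1` cut pattern is unchanged on re-embedded handles (same residue mod `3`).
[folklore] -/
theorem cPat_succ_castAdd (ℓ : ℕ) (k : Fin 3) (i : Fin (3 + 3 * ℓ)) :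
    cPat (ℓ + 1) k (Fin.castAdd 3 i : Fin (3 + 3 * ℓ + 3)) = cPat ℓ k i := rfl

/-- The cut patterns on the three new handles `g, g+1, g+2` (`g = 3 + 3ℓ ≡ 0 (mod 3)`) are those
of the genus-`3` handles `0, 1, 2`. [folklore] -/
theorem cPat_succ_natAdd (ℓ : ℕ) (k : Fin 3) :
    cPat (ℓ + 1) 1 (Fin.natAdd (3 + 3 * ℓ) k : Fin (3 + 3 * ℓ + 3)) = cPat 0 1 k := by
  have hv : @Fin.val (3 + 3 * (ℓ + 1)) (Fin.natAdd (3 + 3 * ℓ) k) = 3 + 3 * ℓ + k := rfl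
  simp only [cPat, hv, decide_eq_decide]
  have := k.is_lt
  omega

/-- `eraseN1 (ℓ+1)` on a re-embedded letter is the re-embedded value of `eraseN1 ℓ`. [folklore] -/
theorem eraseN1_succ_castAdd (ℓ : ℕ) (i : Fin (3 + 3 * ℓ)) (β : Bool) :
    eraseN1 (ℓ + 1) (PresentedGroup.of ((Fin.castAdd 3 i : Fin (3 + 3 * ℓ + 3)), β)) =
      FreeGroup.map (Fin.castAdd 3) (eraseN1 ℓ (PresentedGroup.of (i, β))) := by
  have hc := cPat_succ_castAdd ℓ 1 i
  cases β <;> cases h : cPat ℓ 1 i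
  · rw [show eraseN1 ℓ (PresentedGroup.of (i, false)) = 1 from
        SurfaceGroup.erase_a_of_eq_false _ h, map_one]
    exact SurfaceGroup.erase_a_of_eq_false _ (hc.trans h)
  · rw [show eraseN1 ℓ (PresentedGroup.of (i, false)) = (FreeGroup.of i)⁻¹ from
        SurfaceGroup.erase_a_of_eq_true _ h, map_inv, FreeGroup.map.of]
    exact SurfaceGroup.erase_a_of_eq_true _ (hc.trans h)
  · rw [show eraseN1 ℓ (PresentedGroup.of (i, true)) = FreeGroup.of i from
        SurfaceGroup.erase_b_of_eq_false _ h, FreeGroup.map.of]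
    exact SurfaceGroup.erase_b_of_eq_false _ (hc.trans h)
  · rw [show eraseN1 ℓ (PresentedGroup.of (i, true)) = 1 from
        SurfaceGroup.erase_b_of_eq_true _ h, map_one]
    exact SurfaceGroup.erase_b_of_eq_true _ (hc.trans h)

/-- Genus comparison between levels `m + n` and `m + (n + 1)`. [folklore] -/
theorem level_le_succ (m n : ℕ) : 3 + 3 * (m + n) ≤ 3 + 3 * (m + (n + 1)) := by omega

/-- The first new handle `3 + 3(m+n)` is a handle of level `m + (n + 1)`. [folklore] -/
theorem lt_level_succ₀ (m n : ℕ) : 3 + 3 * (m + n) < 3 + 3 * (m + (n + 1)) := by omega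

/-- The second new handle `3 + 3(m+n) + 1` is a handle of level `m + (n + 1)`. [folklore] -/
theorem lt_level_succ₁ (m n : ℕ) : 3 + 3 * (m + n) + 1 < 3 + 3 * (m + (n + 1)) := by omega

/-- `levelIncl m (n+1)` factors through `levelIncl m n`. [folklore] -/
theorem levelIncl_succ_apply (m n : ℕ) (x : FreeGroup (Fin (3 + 3 * m))) :
    levelIncl m (n + 1) x = FreeGroup.map (Fin.castLE (level_le_succ m n)) (levelIncl m n x) := by
  simp only [levelIncl]
  rw [FreeGroup.map.comp]
  rfl

/-- **The standard generators one level up**: the level-included shadow and new generators at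
level `m + (n+1)` are those of level `m + n` pushed up one level, together with `x_g, x_{g+1}`
(`g = 3 + 3(m+n)`; `x_{g+2}` is excluded as `g + 2 ≡ 2 (mod 3)`). [folklore] -/
theorem levelIncl_succ_union (m n : ℕ) (E : Set (FreeGroup (Fin (3 + 3 * m)))) :
    levelIncl m (n + 1) '' E ∪ newStdGens m (n + 1) =
      FreeGroup.map (Fin.castLE (level_le_succ m n)) '' (levelIncl m n '' E ∪ newStdGens m n) ∪
        {FreeGroup.of ⟨3 + 3 * (m + n), lt_level_succ₀ m n⟩,
          FreeGroup.of ⟨3 + 3 * (m + n) + 1, lt_level_succ₁ m n⟩} := by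
  ext w
  constructor
  · rintro (⟨x, hx, rfl⟩ | ⟨i, ⟨h1, h2⟩, rfl⟩)
    · exact Or.inl ⟨levelIncl m n x, Or.inl ⟨x, hx, rfl⟩, (levelIncl_succ_apply m n x).symm⟩
    · by_cases hlt : (i : ℕ) < 3 + 3 * (m + n)
      · exact Or.inl ⟨FreeGroup.of ⟨i, hlt⟩, Or.inr ⟨⟨i, hlt⟩, ⟨h1, h2⟩, rfl⟩, rfl⟩
      · have hi := i.is_lt
        rcases (show (i : ℕ) = 3 + 3 * (m + n) ∨ (i : ℕ) = 3 + 3 * (m + n) + 1 by omega)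
          with h | h
        · exact Or.inr (Or.inl (congrArg FreeGroup.of (Fin.ext h)))
        · exact Or.inr (Or.inr (congrArg FreeGroup.of (Fin.ext h)))
  · rintro (⟨y, hy, rfl⟩ | hw)
    · rcases hy with ⟨x, hx, rfl⟩ | ⟨i, ⟨h1, h2⟩, rfl⟩
      · exact Or.inl ⟨x, hx, levelIncl_succ_apply m n x⟩
      · exact Or.inr ⟨Fin.castLE (level_le_succ m n) i, ⟨h1, h2⟩, rfl⟩
    · rcases hw with rfl | rfl
      · exact Or.inr ⟨⟨3 + 3 * (m + n), lt_level_succ₀ m n⟩,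
          ⟨(by show 3 + 3 * m ≤ 3 + 3 * (m + n); omega),
            (by show (3 + 3 * (m + n)) % 3 ≠ 2; omega)⟩, rfl⟩
      · exact Or.inr ⟨⟨3 + 3 * (m + n) + 1, lt_level_succ₁ m n⟩,
          ⟨(by show 3 + 3 * m ≤ 3 + 3 * (m + n) + 1; omega),
            (by show (3 + 3 * (m + n) + 1) % 3 ≠ 2; omega)⟩, rfl⟩

/-- **The one-step identity through the transport.**  For `L` at level `ℓ` and the transport of
`L.stabilize` to level `ℓ' = ℓ + 1`:
`erase (L.stabilize)₂ = ⟪ι (erase L₂) ∪ {x_{3+3ℓ}, x_{3+3ℓ+1}}⟫`. [folklore] -/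
theorem map_eraseN1_stabilize_cast {ℓ ℓ' : ℕ} (L : TrisectionKernels (3 + 3 * ℓ))
    (e' : 3 + 3 * ℓ + 3 = 3 + 3 * ℓ') (hℓ : ℓ' = ℓ + 1) (h : 3 + 3 * ℓ ≤ 3 + 3 * ℓ')
    (h₀ : 3 + 3 * ℓ < 3 + 3 * ℓ') (h₁ : 3 + 3 * ℓ + 1 < 3 + 3 * ℓ') :
    ((L.stabilize.cast e') 2).map (eraseN1 ℓ') =
      normalClosure (FreeGroup.map (Fin.castLE h) '' ((L 2).map (eraseN1 ℓ) : Set _) ∪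
        {FreeGroup.of ⟨3 + 3 * ℓ, h₀⟩, FreeGroup.of ⟨3 + 3 * ℓ + 1, h₁⟩}) := by
  subst hℓ
  exact map_stabilize_two L (eraseN1 ℓ) (eraseN1 (ℓ + 1)) (eraseN1_surjective _)
    (eraseN1_succ_castAdd ℓ)
    (SurfaceGroup.erase_a_of_eq_false _ (cPat_succ_natAdd ℓ 0))
    (SurfaceGroup.erase_b_of_eq_false _ (cPat_succ_natAdd ℓ 0))
    (SurfaceGroup.erase_a_of_eq_true _ (cPat_succ_natAdd ℓ 1))
    (SurfaceGroup.erase_b_of_eq_true _ (cPat_succ_natAdd ℓ 1))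
    (SurfaceGroup.erase_a_of_eq_false _ (cPat_succ_natAdd ℓ 2))

/-! ## §4 The stub -/

/-- No new standard generators before stabilising. [folklore] -/
theorem newStdGens_zero (m : ℕ) : newStdGens m 0 = ∅ := by
  refine Set.eq_empty_of_forall_notMem ?_
  rintro _ ⟨i, ⟨hi, -⟩, rfl⟩
  have := i.is_lt
  omega

/-- `levelIncl m 0` is the identity on sets. [folklore] -/
theorem image_levelIncl_zero (m : ℕ) (E : Set (FreeGroup (Fin (3 + 3 * m)))) :
    levelIncl m 0 '' E = E := by
  have hid : ∀ x : FreeGroup (Fin (3 + 3 * m)), levelIncl m 0 x = x := fun x => FreeGroup.map.id x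
  ext w
  constructor
  · rintro ⟨x, hx, rfl⟩
    rwa [hid]
  · exact fun hw => ⟨w, hw, hid w⟩

/-- **`n = 0`**: the erasure of a normal `K₂` is normal (the erasure is surjective), so it is its
own normal closure. [folklore] -/
theorem eraseStabilize_zero (m : ℕ) (K : TrisectionKernels (3 + 3 * m)) (hK : (K 2).Normal) :
    (((K.stabilizeIter 0).cast (level_add m 0)) 2).map (eraseN1 (m + 0)) =
      normalClosure (levelIncl m 0 '' ((K 2).map (eraseN1 m) : Set _) ∪ newStdGens m 0) := by
  haveI : ((K 2).map (eraseN1 m)).Normal := hK.map _ (eraseN1_surjective m)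
  rw [newStdGens_zero, Set.union_empty, image_levelIncl_zero]
  exact (normalClosure_eq_self ((K 2).map (eraseN1 m))).symm

/-- **`n → n + 1`**: one more stabilisation (`map_eraseN1_stabilize_cast` at level `m + n`), the
induction hypothesis inside the normal closure (`normalClosure_image_normalClosure_union`), and the
generators one level up (`levelIncl_succ_union`). [folklore] -/
theorem eraseStabilize_succ {g m n : ℕ} (L : TrisectionKernels g) (e : g = 3 + 3 * (m + n))
    (e' : g + 3 = 3 + 3 * (m + (n + 1))) {E : Set (FreeGroup (Fin (3 + 3 * m)))}
    (ih : ((L.cast e) 2).map (eraseN1 (m + n)) =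
      normalClosure (levelIncl m n '' E ∪ newStdGens m n)) :
    ((L.stabilize.cast e') 2).map (eraseN1 (m + (n + 1))) =
      normalClosure (levelIncl m (n + 1) '' E ∪ newStdGens m (n + 1)) := by
  subst e
  rw [TrisectionKernels.cast_rfl] at ih
  rw [map_eraseN1_stabilize_cast L e' rfl (level_le_succ m n) (lt_level_succ₀ m n)
      (lt_level_succ₁ m n), ih, normalClosure_image_normalClosure_union, ← levelIncl_succ_union]

/-- **STUB `stub_eraseStabilize`** (registered signature, verbatim): the `(1,2)` free shadow of the
`n`-fold stabilisation of `K` is the level-included free shadow of `K` together with the standard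
new generators — `erase ((K # n·K_{S⁴})₂) = ⟪ι (erase K₂) ∪ {xᵢ : 3+3m ≤ i, i ≢ 2 (3)}⟫`.
[folklore] -/
theorem stub_eraseStabilize : EraseStabilize := by
  intro m n
  induction n with
  | zero => exact fun K hK => eraseStabilize_zero m K hK
  | succ n ih =>
    intro K hK
    exact eraseStabilize_succ (K.stabilizeIter n) (level_add m n) (level_add m (n + 1)) (ih K hK)

end Summit.SmoothPoincare4.SmoothPoincare4.Theorems.NormalFormStablyTrivial.Luft

end
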